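import Summits.CriticalPhenomena.PercolationContinuityZ3.Theorems.PercNearOneGluingNoHeavyLowerTailSahiGridPattern

/-!
# `NoHeavyLowerTail` (crux stmt-CriticalPhenomena-4575), Sahi programme P1: **CATERPILLAR READ-ONCE FORMULAS** — definitions

Support file (Sahi cell, seat `prim-sahi-p1`, generation 26; `--supports stmt-CriticalPhenomena-4575`).  Two small DEFINITIONS
(reviewed) and their bookkeeping lemmas; no `sorry`, standard axioms.  They are the vocabulary of the CATERPILLAR READ-ONCE THEOREM
(`…SahiGridPatternCaterpillar`): Kahn's `E₃(1_A,1_B,1_C) ≥ 0` whenever `A` is cut out by a caterpillar read-once monotone formula.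

* `catEval K ops v w : Bool` — the value of the CATERPILLAR (linear read-once) formula with `K` literal values `v : Fin K → Bool`,
  connectives `ops : Fin K → Bool` (`true` = OR, `false` = AND) and seed `w`, nested from the outside in:
    `catEval K ops v w = v 0 ⋄₀ (v 1 ⋄₁ (v 2 ⋄₂ ( ⋯ (v (K-1) ⋄_{K-1} w) ⋯ )))`.
  Every read-once monotone Boolean formula whose parse tree is a caterpillar (each ∧/∨ gate has at most one non-literal input) is of
  this form, e.g. `x₁ ∧ (x₂ ∨ (x₃ ∧ (x₄ ∨ x₅)))`, every clause, every monomial, `(x₁ ∨ x₂ ∨ x₃) ∧ x₄ ∧ x₅`, a clause ∨ a monomial.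
* `litVal o u : Bool` — the value at `u ∈ [3] = Fin 3` of a threshold literal of the small cube with threshold `o : Option (Fin 3)`:
  `litVal (some t) u = [t ≤ u]`, `litVal none u = false` (the never-satisfied literal).  These are exactly the pull-backs of a grid
  literal `[c ≤ x_a]` along a sorted three-point sample (`threshold_three_le`), which is why the pattern-level theorem is stated for them.
Lemmas: unfolding (`catEval_zero`, `catEval_succ`), monotonicity in the literal values (`catEval_mono`), `litVal_mono`, `litVal_some_zero`,
`litVal_none`.  Nothing here asserts `PatternPos d` for `d ≥ 4`. [this work]
-/

namespace Summit.CriticalPhenomena.PercolationContinuityZ3.Theorems.SahiGridPattern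

/-- **Caterpillar read-once formula, evaluated**: `catEval K ops v w = v 0 ⋄₀ (v 1 ⋄₁ ( ⋯ (v (K-1) ⋄_{K-1} w)))` with
`⋄ᵢ = ∨` if `ops i = true` and `⋄ᵢ = ∧` if `ops i = false`; `w` is the innermost constant (seed). [this work] -/
def catEval : (K : ℕ) → (Fin K → Bool) → (Fin K → Bool) → Bool → Bool
  | 0, _, _, w => w
  | K + 1, ops, v, w =>
      if ops 0 = true then v 0 || catEval K (fun j => ops j.succ) (fun j => v j.succ) w
      else v 0 && catEval K (fun j => ops j.succ) (fun j => v j.succ) w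

/-- No literal: the value is the seed. [this work] -/
@[simp] theorem catEval_zero (ops v : Fin 0 → Bool) (w : Bool) : catEval 0 ops v w = w := rfl

/-- Peeling the outermost literal. [this work] -/
theorem catEval_succ {K : ℕ} (ops v : Fin (K + 1) → Bool) (w : Bool) :
    catEval (K + 1) ops v w =
      (if ops 0 = true then v 0 || catEval K (fun j => ops j.succ) (fun j => v j.succ) w
       else v 0 && catEval K (fun j => ops j.succ) (fun j => v j.succ) w) := rfl

/-- A caterpillar formula is monotone in its literal values. [this work] -/
theorem catEval_mono : ∀ (K : ℕ) (ops : Fin K → Bool) {v v' : Fin K → Bool},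
    (∀ i, v i = true → v' i = true) → ∀ w : Bool, catEval K ops v w = true → catEval K ops v' w = true
  | 0 => by
      intro ops v v' _ w h
      simpa using h
  | K + 1 => by
      intro ops v v' hv w h
      have ih := catEval_mono K (fun j => ops j.succ) (v := fun j => v j.succ) (v' := fun j => v' j.succ)
        (fun j hj => hv _ hj) w
      rw [catEval_succ] at h ⊢
      by_cases h0 : ops 0 = true
      · rw [if_pos h0, Bool.or_eq_true] at h ⊢
        rcases h with h | h
        · exact Or.inl (hv 0 h)
        · exact Or.inr (ih h)
      · rw [if_neg h0, Bool.and_eq_true] at h ⊢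
        exact ⟨hv 0 h.1, ih h.2⟩

/-- **Threshold literal of the small cube**: `litVal (some t) u = [t ≤ u]`, `litVal none u = false`. [this work] -/
def litVal (o : Option (Fin 3)) (u : Fin 3) : Bool := o.elim false (fun t => decide (t ≤ u))

/-- The never-satisfied literal. [this work] -/
@[simp] theorem litVal_none (u : Fin 3) : litVal none u = false := rfl

/-- The literal `[t ≤ u]`. [this work] -/
@[simp] theorem litVal_some (t u : Fin 3) : litVal (some t) u = decide (t ≤ u) := rfl

/-- The always-satisfied literal `[0 ≤ u]`. [this work] -/
theorem litVal_some_zero (u : Fin 3) : litVal (some 0) u = true := by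
  rw [litVal_some]; exact decide_eq_true (Fin.zero_le _)

/-- Threshold literals are monotone. [this work] -/
theorem litVal_mono {o : Option (Fin 3)} {u u' : Fin 3} (h : u ≤ u') (hu : litVal o u = true) : litVal o u' = true := by
  cases o with
  | none => simp at hu
  | some t =>
      rw [litVal_some, decide_eq_true_iff] at hu ⊢
      exact le_trans hu h

end Summit.CriticalPhenomena.PercolationContinuityZ3.Theorems.SahiGridPattern
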